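import Mathlib
import Literature.Analysis.SpecialFunctions.AssociatedLegendreHilbertBasis
import HarnessLib

/-!
# Completeness of the oblate spheroidal harmonics of every azimuthal order `m`

Topic `Literature/Analysis/SpecialFunctions` (namespace `Literature.Analysis.SpecialFunctions`),
continuing `AssociatedLegendreHilbertBasis.lean` (for each `m` the Hilbert basis
`e_k^{(m)} = c_{m,k} (1 - x²)^{m/2} q_k^{(m)}` of `L²([-1, 1])`, `q_k^{(m)}` the monic orthogonal
polynomials of the weight `(1 - x²)^m`) and `OblateSpheroidalCompleteness.lean` (the case `m = 0`).

Dafermos–Rodnianski–Shlapentokh-Rothman (arXiv:1402.7034 = Ann. of Math. 183 (2016)), §5.2.1: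
the eigenfunctions `S_{mℓ}(ν, cos θ) e^{imφ}` of
`P(ν) = -(1/sin θ)∂_θ(sin θ ∂_θ) - ∂_φ²/sin²θ - ν² cos²θ` form a complete orthonormal basis of
`L²(sin θ dθ dφ)` with `λ_{mℓ}(ν) + ν² ≥ |m|(|m|+1)`. On the sector of azimuthal number `m`, writing
the smooth eigenfunctions as `S = sin^{|m|} θ · q(cos θ)` (`SpheroidalHarmonicEigenfunction.lean`),
`P(ν)` becomes, on `q`, the operator
`T_m q = -(1 - x²) q'' + 2(m+1) x q' + m(m+1) q`, minus `ν² x²`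
(`(1-x²)^{m/2} T_m q = P(0)|_m [(1-x²)^{m/2} q]`, the reduction used by Shlapentokh-Rothman,
CMP 329, §2 (2.1)). This file proves:

* `assocLegOp m` (`T_m`) on `ℝ[X]`: the divergence form
  `(T_m p)(1-X²)^m = -((1-X²)^{m+1} p')' + m(m+1) p (1-X²)^m` (`assocLegOp_mul_weight`), the
  **weighted symmetry** `B_m(T_m p, q) = ∫ (1-x²)^{m+1} p' q' + m(m+1) B_m(p, q) = B_m(p, T_m q)`
  (`assocLegForm_assocLegOp`, `assocLegForm_assocLegOp_comm`), the coefficient formula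
  (`coeff_assocLegOp`, top coefficient `(d+m)(d+m+1)`), `deg T_m p ≤ deg p`;
* **`T_m q_k = (k+m)(k+m+1) q_k`** (`assocLegOp_assocLegPoly`) — the Gegenbauer differential
  equation, proved from orthogonality alone: `R = T_m q_k - (k+m)(k+m+1) q_k` has degree `< k`, is
  `B_m`-orthogonal to `q_k` and to `T_m q_k` (symmetry), hence `B_m(R, R) = 0`, so `R = 0`;
  consequently the diagonal operator `diag((k+m)(k+m+1))` in the basis `e^{(m)}` acts on weighted
  polynomial classes as `(1-x²)^{m/2} T_m` (`inner_assocLegBasis_assocLegOp`);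
* `exists_hilbertBasis_oblateSpheroidal m ν` — **for every `m ∈ ℕ` and real `ν` a Hilbert basis
  `(S_j)` of `L²([-1, 1])` of eigenfunctions of the order-`m` oblate spheroidal operator with real
  eigenvalues `λ_j → +∞` and `λ_j + ν² ≥ m(m+1)`** (the printed bound `λ + ν² ≥ |m|(|m|+1)`), in
  coefficients `(k+m)(k+m+1) ⟨e_k, S_j⟩ - ν² ⟨e_k, x² S_j⟩ = λ_j ⟨e_k, S_j⟩`;
* `inner_oblateSpheroidal_assocLegOp` — the weak equation against the weighted polynomial classes:
  `⟨S_j, (1-x²)^{m/2} T_m p⟩ - ν² ⟨S_j, x² (1-x²)^{m/2} p⟩ = λ_j ⟨S_j, (1-x²)^{m/2} p⟩`.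

Not treated here (sequel): the identification of the `S_j` with smooth functions
`(1-x²)^{m/2} E_j(x)` solving the spheroidal equation (the shooting eigenfunctions `sphmEig`), the
second printed bound `λ + ν² ≥ 2|mν|`, and the assembly over `m ∈ ℤ` with `e^{imφ}` into a Hilbert
basis of `L²(S²)`. Everything is PROVED; no named facts.

## References

* M. Dafermos, I. Rodnianski, Y. Shlapentokh-Rothman, arXiv:1402.7034 = Ann. of Math. 183 (2016),
  §5.2.1. [DafermosRodnianskiShlapentokhrothman2014]
* Y. Shlapentokh-Rothman, Comm. Math. Phys. 329 (2014), §2 (2.1) and App. B (the reduction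
  `S = sin^m θ · E`). [ShlapentokhRothman2014KleinGordon]
* G. E. Andrews, R. Askey, R. Roy, *Special Functions*, CUP 1999, §6.4 (the ultraspherical
  differential equation). [AndrewsAskeyRoy1999]
-/

noncomputable section

open MeasureTheory Set Filter Topology Polynomial Finset Literature.Analysis.OperatorTheory
open scoped ENNReal InnerProductSpace ComplexConjugate

namespace Literature.Analysis.SpecialFunctions

/-! ### The order-`m` operator `T_m` on polynomials -/

/-- **The order-`m` associated Legendre operator on the polynomial factor**:
`T_m p = 2(m+1) X p' - p'' + X² p'' + m(m+1) p = -(1-X²) p'' + 2(m+1) X p' + m(m+1) p`.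
[cite: ShlapentokhRothman2014KleinGordon, §2 (2.1)] -/
def assocLegOp (m : ℕ) (p : ℝ[X]) : ℝ[X] :=
  C (2 * ((m : ℝ) + 1)) * (X ^ 1 * derivative p) - derivative (derivative p) +
    X ^ 2 * derivative (derivative p) + C ((m : ℝ) * (m + 1)) * p

/-- For `m = 0`, `T_0` is the Legendre operator. [folklore] -/
theorem assocLegOp_zero (p : ℝ[X]) : assocLegOp 0 p = legendreOp p := by
  rw [assocLegOp, legendreOp_eq]
  simp only [Nat.cast_zero, zero_add, mul_one, zero_mul, map_zero, zero_mul, add_zero]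

/-- `T_m` is additive. [folklore] -/
theorem assocLegOp_add (m : ℕ) (p q : ℝ[X]) :
    assocLegOp m (p + q) = assocLegOp m p + assocLegOp m q := by
  simp only [assocLegOp, derivative_add, mul_add]
  ring

/-- `T_m` is homogeneous. [folklore] -/
theorem assocLegOp_C_mul (m : ℕ) (c : ℝ) (p : ℝ[X]) :
    assocLegOp m (C c * p) = C c * assocLegOp m p := by
  simp only [assocLegOp, derivative_mul, derivative_C, zero_mul, zero_add]
  ring

/-- `T_m (p - q) = T_m p - T_m q`. [folklore] -/
theorem assocLegOp_sub (m : ℕ) (p q : ℝ[X]) :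
    assocLegOp m (p - q) = assocLegOp m p - assocLegOp m q := by
  simp only [assocLegOp, derivative_sub, mul_sub]
  ring

/-- **The divergence form**: `(T_m p) (1-X²)^m = -((1-X²)^{m+1} p')' + m(m+1) p (1-X²)^m`.
[folklore] -/
theorem assocLegOp_mul_weight (m : ℕ) (p : ℝ[X]) :
    assocLegOp m p * assocLegWeight m =
      -derivative ((1 - X ^ 2) ^ (m + 1) * derivative p) +
        C ((m : ℝ) * (m + 1)) * (p * assocLegWeight m) := by
  rw [assocLegOp, assocLegWeight, derivative_mul, derivative_pow, derivative_sub, derivative_one,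
    derivative_X_pow, Nat.add_sub_cancel]
  simp only [Nat.cast_ofNat, pow_one, Nat.cast_add, Nat.cast_one, map_add, map_one]
  simp only [C_add, C_mul, C_1]
  ring

/-- **The weighted symmetric form of `T_m`**:
`B_m(T_m p, q) = ∫_{-1}^1 (1-x²)^{m+1} p' q' + m(m+1) B_m(p, q)` (integration by parts; the boundary
factor `(1-x²)^{m+1}` vanishes at `±1`). [folklore] -/
theorem assocLegForm_assocLegOp (m : ℕ) (p q : ℝ[X]) :
    assocLegForm m (assocLegOp m p) q =
      polyIntegral ((1 - X ^ 2) ^ (m + 1) * derivative p * derivative q) +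
        (m : ℝ) * (m + 1) * assocLegForm m p q := by
  have hmul : assocLegOp m p * q * assocLegWeight m =
      -(derivative ((1 - X ^ 2) ^ (m + 1) * derivative p) * q) +
        C ((m : ℝ) * (m + 1)) * (p * q * assocLegWeight m) := by
    rw [mul_right_comm, assocLegOp_mul_weight]
    ring
  rw [assocLegForm, hmul, map_add, map_neg, C_mul', map_smul, smul_eq_mul, ← assocLegForm]
  congr 1
  -- integration by parts
  rw [polyIntegral_apply, polyIntegral_apply]
  simp only [eval_mul]
  have h := integral_derivative_mul ((1 - X ^ 2) ^ (m + 1) * derivative p) q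
  have hb : ∀ s : ℝ, s = 1 ∨ s = -1 → ((1 - X ^ 2) ^ (m + 1) * derivative p : ℝ[X]).eval s = 0 := by
    rintro s (rfl | rfl) <;> simp
  rw [hb 1 (Or.inl rfl), hb (-1) (Or.inr rfl), zero_mul, zero_mul, sub_zero, zero_sub] at h
  rw [h, neg_neg]
  refine intervalIntegral.integral_congr fun x _ ↦ ?_
  simp only [eval_mul]

/-- **`T_m` is symmetric for `B_m`**: `B_m(T_m p, q) = B_m(p, T_m q)`. [folklore] -/
theorem assocLegForm_assocLegOp_comm (m : ℕ) (p q : ℝ[X]) :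
    assocLegForm m (assocLegOp m p) q = assocLegForm m p (assocLegOp m q) := by
  rw [assocLegForm_comm m p, assocLegForm_assocLegOp, assocLegForm_assocLegOp, assocLegForm_comm m q p]
  congr 1
  rw [mul_right_comm]

/-- **The coefficient formula**: if `p` has no term of degree `d + 2` then
`(T_m p)_d = (d+m)(d+m+1) p_d`. [folklore] -/
theorem coeff_assocLegOp (m : ℕ) {p : ℝ[X]} {d : ℕ} (h2 : p.coeff (d + 2) = 0) :
    (assocLegOp m p).coeff d = ((d : ℝ) + m) * (d + m + 1) * p.coeff d := by
  rw [assocLegOp]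
  simp only [coeff_add, coeff_sub, coeff_C_mul, coeff_X_pow_mul', coeff_derivative]
  rcases d with _ | _ | k
  · norm_num at h2 ⊢
    rw [h2]
  · norm_num at h2 ⊢
    rw [h2]
    ring
  · have h1 : 1 ≤ k + 2 := by omega
    have h2' : 2 ≤ k + 2 := by omega
    simp only [h1, h2', if_true, show k + 2 - 1 = k + 1 by omega, show k + 2 - 2 = k by omega]
    rw [show k + 2 + 1 + 1 = k + 2 + 2 from rfl, h2]
    push_cast
    ring

/-- **`deg T_m p ≤ deg p`.** [folklore] -/
theorem natDegree_assocLegOp_le (m : ℕ) (p : ℝ[X]) : (assocLegOp m p).natDegree ≤ p.natDegree := by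
  rw [natDegree_le_iff_coeff_eq_zero]
  intro N hN
  rw [coeff_assocLegOp m (coeff_eq_zero_of_natDegree_lt (by omega)),
    coeff_eq_zero_of_natDegree_lt hN, mul_zero]

/-- The levels `d_k^{(m)} = (k+m)(k+m+1)`. [folklore] -/
def assocLegLevel (m k : ℕ) : ℝ := ((k : ℝ) + m) * (k + m + 1)

/-- `d_k^{(m)} ≥ m(m+1)`. [folklore] -/
theorem assocLegLevel_ge (m k : ℕ) : (m : ℝ) * (m + 1) ≤ assocLegLevel m k := by
  rw [assocLegLevel]
  nlinarith [k.cast_nonneg (α := ℝ), m.cast_nonneg (α := ℝ)]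

/-- `d_k^{(m)} → +∞`. [folklore] -/
theorem tendsto_assocLegLevel (m : ℕ) : Tendsto (assocLegLevel m) cofinite atTop := by
  rw [Nat.cofinite_eq_atTop]
  refine tendsto_atTop_mono (fun k ↦ ?_) tendsto_natCast_atTop_atTop
  rw [assocLegLevel]
  nlinarith [k.cast_nonneg (α := ℝ), m.cast_nonneg (α := ℝ)]

/-- **The Gegenbauer differential equation from orthogonality**: `T_m q_k = (k+m)(k+m+1) q_k` for
the monic orthogonal polynomials of the weight `(1-x²)^m`. Proof: `R = T_m q_k - (k+m)(k+m+1) q_k`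
has `deg R ≤ k` and vanishing degree-`k` coefficient (`coeff_assocLegOp`); it is `B_m`-orthogonal to
`q_k` (lower degree) and `B_m(R, T_m q_k) = B_m(T_m R, q_k) = 0` (symmetry, `deg T_m R < k`), so
`B_m(R, R) = 0` and `R = 0` by positive definiteness.
[cite: AndrewsAskeyRoy1999, §6.4 (the ultraspherical equation)] -/
theorem assocLegOp_assocLegPoly (m k : ℕ) :
    assocLegOp m (assocLegPoly m k) = C (assocLegLevel m k) * assocLegPoly m k := by
  set R : ℝ[X] := assocLegOp m (assocLegPoly m k) - C (assocLegLevel m k) * assocLegPoly m k with hR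
  suffices hR0 : R = 0 by rwa [hR, sub_eq_zero] at hR0
  by_contra hR0
  -- `deg R < k`
  have hdegle : R.natDegree ≤ k := by
    refine (natDegree_sub_le _ _).trans (max_le ?_ ?_)
    · exact (natDegree_assocLegOp_le _ _).trans (natDegree_assocLegPoly m k).le
    · exact (natDegree_C_mul_le _ _).trans (natDegree_assocLegPoly m k).le
  have hcoeff : R.coeff k = 0 := by
    rw [hR, coeff_sub, coeff_C_mul, coeff_assocLegOp m (coeff_eq_zero_of_natDegree_lt
      (by rw [natDegree_assocLegPoly]; omega))]
    have hl : (assocLegPoly m k).coeff k = 1 := by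
      have := monic_assocLegPoly m k
      rw [Monic, leadingCoeff, natDegree_assocLegPoly] at this
      exact this
    rw [hl, assocLegLevel]
    ring
  have hdeg : R.natDegree < k := by
    refine lt_of_le_of_ne hdegle fun h ↦ hR0 ?_
    rw [← leadingCoeff_eq_zero, leadingCoeff, h, hcoeff]
  -- `B_m(R, R) = 0`
  have hRR : assocLegForm m R R = 0 := by
    have h1 : assocLegForm m R (assocLegPoly m k) = 0 := by
      rw [assocLegForm_comm]
      exact assocLegForm_assocLegPoly_of_natDegree_lt m hdeg
    have h2 : assocLegForm m R (assocLegOp m (assocLegPoly m k)) = 0 := by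
      rw [← assocLegForm_assocLegOp_comm, assocLegForm_comm]
      exact assocLegForm_assocLegPoly_of_natDegree_lt m ((natDegree_assocLegOp_le _ _).trans_lt hdeg)
    have h3 : assocLegForm m R R = assocLegForm m R (assocLegOp m (assocLegPoly m k)) -
        assocLegLevel m k * assocLegForm m R (assocLegPoly m k) := by
      conv_lhs => rw [hR]
      rw [assocLegForm_comm, assocLegForm_sub_left, assocLegForm_C_mul_left, assocLegForm_comm,
        assocLegForm_comm m (assocLegPoly m k)]
    rw [h3, h1, h2, mul_zero, sub_zero]
  exact absurd hRR (assocLegForm_self_pos m hR0).ne'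

/-- **The diagonal operator `diag((k+m)(k+m+1))` in the basis `e^{(m)}` is `(1-x²)^{m/2} T_m`** on
weighted polynomial classes: `⟨e_k, (1-x²)^{m/2} T_m p⟩ = (k+m)(k+m+1) ⟨e_k, (1-x²)^{m/2} p⟩`.
[folklore] -/
theorem inner_assocLegBasis_assocLegOp (m k : ℕ) (p : ℝ[X]) :
    ⟪assocLegBasis m k, assocLegL2 m (assocLegOp m p)⟫_ℂ =
      (assocLegLevel m k : ℂ) * ⟪assocLegBasis m k, assocLegL2 m p⟫_ℂ := by
  rw [inner_assocLegBasis_assocLegL2, inner_assocLegBasis_assocLegL2, ← Complex.ofReal_mul]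
  congr 1
  rw [← assocLegForm_assocLegOp_comm, assocLegOp_assocLegPoly, assocLegForm_C_mul_left]
  ring

/-! ### The order-`m` oblate spheroidal eigenbasis -/

/-- **Completeness of the oblate spheroidal harmonics of azimuthal order `m`.** For every `m ∈ ℕ`
and real `ν` there are a Hilbert basis `(S_j)_{j ∈ s}` of `L²([-1, 1])` (indexed by a subset `s`,
`S_j = j`) and real eigenvalues `λ_j` with `λ_j → +∞` along the cofinite filter and
**`λ_j + ν² ≥ m(m+1)`** (DRSR (5.2.1): `λ_{mℓ} + ν² ≥ |m|(|m|+1)`), such that each `S_j` is an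
eigenfunction of the order-`m` oblate spheroidal operator `A_m - ν² x²` with eigenvalue `λ_j`, where
`A_m = diag((k+m)(k+m+1))` in the basis `e_k^{(m)} = c_{m,k} (1-x²)^{m/2} q_k^{(m)}`
(`assocLegBasis m`) is the operator `(1-x²)^{m/2} q ↦ (1-x²)^{m/2} T_m q`
(`inner_assocLegBasis_assocLegOp`) — i.e. `P(0)` on the sector `sin^m θ q(cos θ) e^{imφ}`; in
coefficients: `(k+m)(k+m+1) ⟨e_k, S_j⟩ - ν² ⟨e_k, x² S_j⟩ = λ_j ⟨e_k, S_j⟩` for all `k`. This is the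
order-`m` sector of "the eigenfunctions of `P(ν)` form a complete orthonormal basis of
`L²(sin θ dθ dφ)`" (DRSR §5.2.1), via `x = cos θ`.
[cite: DafermosRodnianskiShlapentokhrothman2014, §5.2.1] -/
theorem exists_hilbertBasis_oblateSpheroidal (m : ℕ) (ν : ℝ) :
    ∃ (s : Set (Lp ℂ 2 legendreMeasure)) (S : HilbertBasis s ℂ (Lp ℂ 2 legendreMeasure))
      (lam : s → ℝ), ⇑S = ((↑) : s → Lp ℂ 2 legendreMeasure) ∧ Tendsto lam cofinite atTop ∧
      (∀ j, (m : ℝ) * (m + 1) - ν ^ 2 ≤ lam j) ∧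
      ∀ j (k : ℕ), (assocLegLevel m k : ℂ) * ⟪assocLegBasis m k, S j⟫_ℂ -
        ((ν ^ 2 : ℝ) : ℂ) * ⟪assocLegBasis m k, mulSq (S j)⟫_ℂ =
          (lam j : ℂ) * ⟪assocLegBasis m k, S j⟫_ℂ := by
  -- the perturbation `B = -ν² x²`, self-adjoint with `‖B‖ ≤ ν²`
  set B : Lp ℂ 2 legendreMeasure →L[ℂ] Lp ℂ 2 legendreMeasure := ((-ν ^ 2 : ℝ) : ℂ) • mulSq with hB
  have hBsa : IsSelfAdjoint B := by
    rw [hB]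
    exact IsSelfAdjoint.smul (by rw [isSelfAdjoint_iff, Complex.star_def, Complex.conj_ofReal])
      isSelfAdjoint_mulSq
  have hBnorm : ‖B‖ ≤ ν ^ 2 := by
    rw [hB, norm_smul, Complex.norm_real, Real.norm_eq_abs, abs_neg, abs_of_nonneg (sq_nonneg ν)]
    calc ν ^ 2 * ‖mulSq‖ ≤ ν ^ 2 * 1 := mul_le_mul_of_nonneg_left norm_mulSq_le (sq_nonneg ν)
      _ = ν ^ 2 := mul_one _
  obtain ⟨s, S, lam, hS, htend, hlow, heq⟩ := exists_hilbertBasis_diag_add (assocLegBasis m)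
    (assocLegLevel m) ((m : ℝ) * (m + 1)) (assocLegLevel_ge m) (tendsto_assocLegLevel m) B hBsa
  refine ⟨s, S, lam, hS, htend, fun j ↦ ?_, fun j k ↦ ?_⟩
  · have := hlow j
    linarith
  · have h := heq j k
    rw [hB] at h
    simp only [FunLike.coe_smul, Pi.smul_apply, inner_smul_right] at h
    push_cast at h ⊢
    linear_combination h

/-- **The weak eigenfunction equation against weighted polynomial test functions.** With `S_j`,
`λ_j` as in `exists_hilbertBasis_oblateSpheroidal`: for every real polynomial `p`,
`⟨S_j, (1-x²)^{m/2} T_m p⟩ - ν² ⟨S_j, x² (1-x²)^{m/2} p⟩ = λ_j ⟨S_j, (1-x²)^{m/2} p⟩`, i.e.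
`S_j` is a distributional solution of the order-`m` oblate spheroidal equation (Parseval in the
basis `e^{(m)}`, `inner_assocLegBasis_assocLegOp`, symmetry of `x²·`). [folklore] -/
theorem inner_oblateSpheroidal_assocLegOp {m : ℕ} {ν : ℝ} {S : Lp ℂ 2 legendreMeasure} {lam : ℝ}
    (heq : ∀ k : ℕ, (assocLegLevel m k : ℂ) * ⟪assocLegBasis m k, S⟫_ℂ -
      ((ν ^ 2 : ℝ) : ℂ) * ⟪assocLegBasis m k, mulSq S⟫_ℂ = (lam : ℂ) * ⟪assocLegBasis m k, S⟫_ℂ)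
    (p : ℝ[X]) :
    ⟪S, assocLegL2 m (assocLegOp m p)⟫_ℂ - ((ν ^ 2 : ℝ) : ℂ) * ⟪S, mulSq (assocLegL2 m p)⟫_ℂ =
      (lam : ℂ) * ⟪S, assocLegL2 m p⟫_ℂ := by
  have hsym : ∀ u v : Lp ℂ 2 legendreMeasure, ⟪mulSq u, v⟫_ℂ = ⟪u, mulSq v⟫_ℂ :=
    fun u v ↦ (ContinuousLinearMap.isSelfAdjoint_iff_isSymmetric.1 isSelfAdjoint_mulSq) u v
  -- Parseval in the basis `e^{(m)}`
  have hP : ∀ u g : Lp ℂ 2 legendreMeasure,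
      HasSum (fun k ↦ ⟪u, assocLegBasis m k⟫_ℂ * ⟪assocLegBasis m k, g⟫_ℂ) ⟪u, g⟫_ℂ :=
    fun u g ↦ (assocLegBasis m).hasSum_inner_mul_inner u g
  rw [← hsym S (assocLegL2 m p)]
  have h1 := hP S (assocLegL2 m (assocLegOp m p))
  have h2 := (hP (mulSq S) (assocLegL2 m p)).mul_left (((ν ^ 2 : ℝ) : ℂ))
  have h3 := (hP S (assocLegL2 m p)).mul_left (lam : ℂ)
  have h12 : HasSum (fun k ↦ ⟪S, assocLegBasis m k⟫_ℂ * ⟪assocLegBasis m k, assocLegL2 m (assocLegOp m p)⟫_ℂ -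
      ((ν ^ 2 : ℝ) : ℂ) * (⟪mulSq S, assocLegBasis m k⟫_ℂ * ⟪assocLegBasis m k, assocLegL2 m p⟫_ℂ))
      (⟪S, assocLegL2 m (assocLegOp m p)⟫_ℂ - ((ν ^ 2 : ℝ) : ℂ) * ⟪mulSq S, assocLegL2 m p⟫_ℂ) :=
    h1.sub h2
  have key : (fun k ↦ ⟪S, assocLegBasis m k⟫_ℂ * ⟪assocLegBasis m k, assocLegL2 m (assocLegOp m p)⟫_ℂ -
      ((ν ^ 2 : ℝ) : ℂ) * (⟪mulSq S, assocLegBasis m k⟫_ℂ * ⟪assocLegBasis m k, assocLegL2 m p⟫_ℂ)) =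
      fun k ↦ (lam : ℂ) * (⟪S, assocLegBasis m k⟫_ℂ * ⟪assocLegBasis m k, assocLegL2 m p⟫_ℂ) := by
    funext k
    rw [inner_assocLegBasis_assocLegOp]
    have hc := congrArg conj (heq k)
    simp only [map_sub, map_mul, Complex.conj_ofReal, inner_conj_symm] at hc
    linear_combination ⟪assocLegBasis m k, assocLegL2 m p⟫_ℂ * hc
  rw [key] at h12
  exact h12.unique h3

end Literature.Analysis.SpecialFunctions
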